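import Summits.FinalStateConjecture.FinalStateConjecture.Theorems.PhotonSphereChannelsDarkFutureDefs
import Summits.FinalStateConjecture.FinalStateConjecture.Theorems.PhotonSphereChannelsChannelsResolveTameDevelopmentsRKerrDocOfLocalIsometry
import Literature.Geometry.Lorentzian.KerrData
import Literature.Geometry.Lorentzian.Isometry
import HarnessLib

/-!
# Route PhotonSphereChannels · crux `ChannelsResolveTameDevelopmentsR` (K2R-T2, stmt-FinalStateConjecture-17430) ·
# line `tame-lasalle-dock` · stub N `stub_noExtremalShadow`: bookkeeping of the sub-extremality test and the typed
# reduction of N to ONE named input, `LateChartFromHullElement` (= "ExtremalLimitPromotion" for one candidate limit)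

Stub N (`NoExtremalShadow`, skeleton `Cruxes/ChannelsResolveTameDevelopmentsR/Lines/tame_lasalle_dock.lean`, Reshape 1
of lead c8) says: for a development as in Φ (`TameHull.DevHyp`: MGHD, complete `𝓘⁺`, (i) `NoExtremalRemnant`, (ii)
`TameOuter`), NO silent hull element `(𝓢, E, p)` (outer, `IsSilentHullElement`, or horizon-based,
`IsHorizonHullElementAlong`) has a domain of outer communications `E.doc` onto which a Kerr exterior `(M', a)`,
`0 < M'`, `|a| ≤ M'`, maps by an injective local isometry of `(Kerr.exterior M' a, Kerr.smoothMetric M' a r₊)` UNLESS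
`|a| < M'` — the SUB-EXTREMALITY TEST (G5) that the docked rigidity SEK (which only returns `|a| ≤ M'`) cannot supply.
This file proves, kernel-checked and without new analytic input:

* §1 **Bookkeeping.** `0 < M' → |a| ≤ M' → (|a| < M' ∨ Kerr.IsExtremal M' a)` (`Kerr_abs_lt_or_isExtremal`), so for
  every region `O ⊆ 𝓢` the sub-extremality test "every Kerr exterior `0 < M'`, `|a| ≤ M'` locally isometric onto `O`
  has `|a| < M'`" is EQUIVALENT to "no EXTREMAL Kerr exterior (`Kerr.IsExtremal M' a`: `|a| = M'`, `0 < M'`) is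
  locally isometric (injectively, onto, either time orientation) onto `O`" (`subextremalTest_iff_noExtremalIsometry`);
  under the binders of N this is `noExtremalShadow_iff_noExtremalIsometricDoc` — N's text ⇔ "no silent hull element of
  a development as in Φ has an extremal isometric d.o.c." (the form the disprover / planner quote; the over-spinning
  case `|a| > M'` never arises).
* §2 **The one named input and the reduction.** `LateChartFromHullElement 𝒟 𝓢 E` ("ExtremalLimitPromotion" for ONE
  candidate limit `(𝓢, E)` of the development `𝒟`): every injective local isometry of an EXTREMAL Kerr exterior
  `(M', a)` onto `E.doc` is PROMOTED to a late-time chart of `𝒟` from a boosted extremal Kerr background of the same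
  mass, `(Λ, c, M', a')`, `Kerr.IsExtremal M' a'`, along which the near-zone `C²` deviation tends to `0` on every
  truncated slab — literally the witness shape that hypothesis (i) `TameHull.NoExtremalRemnant 𝒟` forbids. Hence
  (i) + `LateChartFromHullElement` contradict an extremal isometric d.o.c. (`abs_lt_of_lateChartFromHullElement`), and
  N's registered text follows VERBATIM from "every silent hull element of a development as in Φ is late-charted"
  (`noExtremalShadow_of_lateChartFromHullElement`, registered sub-goal). Honesty clause: that hypothesis is in fact
  EQUIVALENT to N (`noExtremalShadow_iff_lateChartFromHullElement`: under N the promotion is vacuous) — the reduction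
  does not weaken N, it only re-types it as the construction a proof must perform (a late CHART of `𝒟` out of a
  SUBSEQUENTIAL pointed `C²_loc` limit), i.e. it isolates ExtremalLimitPromotion (TSOA dead note; lead c7) as the one
  missing input. Its intended producers — parameter pinning along the generator by the two monotone budgets (so that
  one extremal element makes every element along `γ` extremal of the same mass) and the late-chart gluing of T′, both
  in their EXTREMAL versions, plus the exclusion of horizonless extremal outer elements (the white-hole patch of
  `Negative/EmptyHorizonEnd`) — are NOT in the tree; see the worker report `work/stubs/stub_noExtremalShadow.md`.

No route item and no neighbouring stub is restated: N's text appears only as a conclusion (§2) or as one side of a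
proved equivalence (§1, §2).

References: B. O'Neill, *The Geometry of Kerr Black Holes* (1995), Ch. 2 §2.3 (`r± = M ± √(M² − a²)`, extremal
`|a| = M`) [ONeill1995]; M. Dafermos, G. Holzegel, I. Rodnianski, M. Taylor, arXiv:2104.08222, §1 (late charts, slab
deviations) [arXiv210408222]; M. Dafermos, J. Luk, arXiv:1710.01722, §1.2.1 (the extremal case of the final state
picture) [DafermosLuk2017]; C. Kehle, R. Unger, arXiv:2211.15742 (extremal black hole formation as a counterexample to
the third law, charged matter) [KehleUnger2022].
-/

noncomputable section

-- the operator-norm instance on `E4 →L[ℝ] E4 →L[ℝ] ℝ` needs one more level of pending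
-- instance problems than the default (as in `PhotonSphereChannelsTameHullDefs.lean`)
set_option maxSynthPendingDepth 3
-- every `Summit.FinalStateConjecture.FinalStateConjecture.…` name repeats the summit = sub-problem segment (D-0017 layout)
set_option linter.dupNamespace false

open Set Filter Function TopologicalSpace Manifold Bundle
open scoped Topology Manifold ContDiff ENNReal NNReal

namespace Summit.FinalStateConjecture.FinalStateConjecture.Theorems.TameLaSalle

open Literature.Geometry.Lorentzian
open Summit.FinalStateConjecture.FinalStateConjecture.Theorems.TameHull
open Summit.FinalStateConjecture.FinalStateConjecture.Theorems.DarkFuture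

/-! ### §1 Bookkeeping: the sub-extremality test is the absence of an EXTREMAL isometric copy -/

/-- **`0 < M'`, `|a| ≤ M'` ⇒ sub-extremal or extremal**: the parameter range returned by the docked rigidity SEK
splits into `Kerr.IsSubextremal` (`|a| < M'`) and `Kerr.IsExtremal` (`|a| = M' ∧ 0 < M'`); the over-spinning case does
not arise. [cite: ONeill1995, Ch. 2 §2.3] -/
theorem Kerr_abs_lt_or_isExtremal {M' a : ℝ} (hM' : 0 < M') (ha : |a| ≤ M') : |a| < M' ∨ Kerr.IsExtremal M' a :=
  (lt_or_eq_of_le ha).imp_right fun h ↦ ⟨h, hM'⟩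

/-- Extremal parameters fail the strict inequality `|a| < M'`. [cite: ONeill1995, Ch. 2 §2.3] -/
theorem Kerr_not_abs_lt_of_isExtremal {M' a : ℝ} (h : Kerr.IsExtremal M' a) : ¬ |a| < M' :=
  fun hlt ↦ absurd h.1 hlt.ne

/-- **The sub-extremality test on a region is the absence of an extremal isometric copy.** For a region `O` of a
spacetime `𝓢`: "every Kerr exterior `(M', a)`, `0 < M'`, `|a| ≤ M'`, admitting an injective local isometry of
`(Kerr.exterior M' a, Kerr.smoothMetric M' a r₊)` onto `O` has `|a| < M'`" holds iff "NO extremal Kerr exterior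
(`Kerr.IsExtremal M' a`) admits an injective local isometry onto `O`" (either time orientation: the local-isometry
clause carries no orientation). Real-number case split `|a| < M' ∨ |a| = M'`. [cite: ONeill1995, Ch. 2 §2.3] -/
theorem subextremalTest_iff_noExtremalIsometry {𝓢 : Spacetime.{0} 4} [Kerr.Facts] (O : Set 𝓢.carrier) :
    (∀ M' a : ℝ, 0 < M' → |a| ≤ M' →
      (∃ Ψ : Kerr.exterior M' a → 𝓢.carrier, Function.Injective Ψ ∧ Set.range Ψ = O ∧
        PseudoRiemannianMetric.IsLocalIsometry
          (Kerr.smoothMetric M' a (Kerr.rPlus M' a)).toPseudoRiemannianMetric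
          𝓢.metric.toPseudoRiemannianMetric Ψ) → |a| < M') ↔
    ∀ M' a : ℝ, Kerr.IsExtremal M' a →
      ¬ ∃ Ψ : Kerr.exterior M' a → 𝓢.carrier, Function.Injective Ψ ∧ Set.range Ψ = O ∧
        PseudoRiemannianMetric.IsLocalIsometry
          (Kerr.smoothMetric M' a (Kerr.rPlus M' a)).toPseudoRiemannianMetric
          𝓢.metric.toPseudoRiemannianMetric Ψ := by
  refine ⟨fun h M' a hext hΨ ↦ ?_, fun h M' a hM' ha hΨ ↦ ?_⟩
  · exact Kerr_not_abs_lt_of_isExtremal hext (h M' a hext.2 hext.1.le hΨ)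
  · rcases Kerr_abs_lt_or_isExtremal hM' ha with hlt | hext
    · exact hlt
    · exact absurd hΨ (h M' a hext)

/-- **N ⇔ "no silent hull element of a development as in Φ has an EXTREMAL isometric d.o.c."** The registered text
of stub N (left) is equivalent to the same text with the sub-extremality test replaced by the absence of an injective
local isometry of an extremal smooth Kerr exterior onto `E.doc` (right) — `subextremalTest_iff_noExtremalIsometry`
under the binders. This is the form of N that the extremal white-hole patch of `Negative/EmptyHorizonEnd` (d.o.c. an
extremal exterior in the past orientation) would have to violate AS A HULL ELEMENT of such a development.
[cite: DafermosLuk2017, §1.2.1] -/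
theorem noExtremalShadow_iff_noExtremalIsometricDoc :
    (∀ (X : Type) [TopologicalSpace X] [ChartedSpace E3 X] [IsManifold (𝓡 3) ∞ X] [T2Space X]
      [SecondCountableTopology X] [ConnectedSpace X], ∀ D ∈ admissibleVacuumData X,
      ∀ (𝒟 : VacuumCauchyDevelopment D) [𝒟.metric.HasLeviCivita], DevHyp 𝒟 →
        ∀ (Λ : ℕ → ℝ≥0) (r₀ : ℝ) (𝓢 : Spacetime.{0} 4) (E : EndDatum 𝓢) (p : 𝓢.carrier),
          ((∃ q : ℕ → 𝒟.carrier, IsSilentHullElement 𝒟 Λ r₀ q 𝓢 E p) ∨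
            (∃ (γ : ℝ → 𝒟.carrier) (s : ℕ → ℝ), IsHorizonPath 𝒟 γ ∧ Tendsto s atTop atTop ∧
              IsHorizonHullElementAlong 𝒟 Λ r₀ γ s 𝓢 E p)) →
          ∀ [Kerr.Facts], ∀ M' a : ℝ, 0 < M' → |a| ≤ M' →
            (∃ Ψ : Kerr.exterior M' a → 𝓢.carrier, Function.Injective Ψ ∧ Set.range Ψ = E.doc ∧
              PseudoRiemannianMetric.IsLocalIsometry
                (Kerr.smoothMetric M' a (Kerr.rPlus M' a)).toPseudoRiemannianMetric
                𝓢.metric.toPseudoRiemannianMetric Ψ) → |a| < M') ↔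
    (∀ (X : Type) [TopologicalSpace X] [ChartedSpace E3 X] [IsManifold (𝓡 3) ∞ X] [T2Space X]
      [SecondCountableTopology X] [ConnectedSpace X], ∀ D ∈ admissibleVacuumData X,
      ∀ (𝒟 : VacuumCauchyDevelopment D) [𝒟.metric.HasLeviCivita], DevHyp 𝒟 →
        ∀ (Λ : ℕ → ℝ≥0) (r₀ : ℝ) (𝓢 : Spacetime.{0} 4) (E : EndDatum 𝓢) (p : 𝓢.carrier),
          ((∃ q : ℕ → 𝒟.carrier, IsSilentHullElement 𝒟 Λ r₀ q 𝓢 E p) ∨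
            (∃ (γ : ℝ → 𝒟.carrier) (s : ℕ → ℝ), IsHorizonPath 𝒟 γ ∧ Tendsto s atTop atTop ∧
              IsHorizonHullElementAlong 𝒟 Λ r₀ γ s 𝓢 E p)) →
          ∀ [Kerr.Facts], ∀ M' a : ℝ, Kerr.IsExtremal M' a →
            ¬ ∃ Ψ : Kerr.exterior M' a → 𝓢.carrier, Function.Injective Ψ ∧ Set.range Ψ = E.doc ∧
              PseudoRiemannianMetric.IsLocalIsometry
                (Kerr.smoothMetric M' a (Kerr.rPlus M' a)).toPseudoRiemannianMetric
                𝓢.metric.toPseudoRiemannianMetric Ψ) := by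
  refine ⟨fun h X _ _ _ _ _ _ D hD 𝒟 _ hdev Λ r₀ 𝓢 E p hel _ ↦ ?_, fun h X _ _ _ _ _ _ D hD 𝒟 _ hdev Λ r₀ 𝓢 E p hel _ ↦ ?_⟩
  · exact (subextremalTest_iff_noExtremalIsometry E.doc).1 (h X D hD 𝒟 hdev Λ r₀ 𝓢 E p hel)
  · exact (subextremalTest_iff_noExtremalIsometry E.doc).2 (h X D hD 𝒟 hdev Λ r₀ 𝓢 E p hel)

/-! ### §2 The one named input `LateChartFromHullElement` and the reduction of N -/

section Development

variable {X : Type} [TopologicalSpace X] [ChartedSpace E3 X] [IsManifold (𝓡 3) ∞ X] [ConnectedSpace X]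
  {D : InitialDataSet (𝓡 3) X}

/-- **`LateChartFromHullElement 𝒟 𝓢 E` — ExtremalLimitPromotion for ONE candidate limit** (the one named input of
stub N; parametrised by the development `𝒟` and the candidate limit end `(𝓢, E)`, asked in the reduction only of
SILENT HULL ELEMENTS of developments as in Φ). Whenever an EXTREMAL Kerr exterior `(M', a)` (`Kerr.IsExtremal M' a`)
maps by an injective local isometry of `(Kerr.exterior M' a, Kerr.smoothMetric M' a r₊)` onto the domain of outer
communications `E.doc`, the development `𝒟` carries a LATE-TIME CHART from a boosted extremal Kerr background of the
same mass — a motion `(Λ, c)`, a spin `a'` with `Kerr.IsExtremal M' a'` (the sign of the spin is a spatial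
reflection, absorbed nowhere else), a time `τ₀` and `Φ : (boostedKerrBackground Λ c M' a').domain → 𝒟` which is a
late chart into `univ` after `τ₀` (`Spacetime.IsLateChart`) with near-zone `C²` deviation
`truncDeviationCk … Φ 2 R τ → 0` as `τ → ∞` for every `R` — verbatim the witness shape forbidden by hypothesis (i)
`TameHull.NoExtremalRemnant 𝒟`. A subsequential pointed `C²_loc` limit (exhausting precompact windows, comparison maps
that need not be compatible from one index to the next) does NOT give such a chart for free: the promotion is the
content (parameters pinned along the generator, then gluing of the comparison maps along all late times).
[cite: arXiv210408222, §1] -/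
def LateChartFromHullElement (𝒟 : VacuumCauchyDevelopment D) (𝓢 : Spacetime.{0} 4) (E : EndDatum 𝓢) : Prop :=
  ∀ [Kerr.Facts], ∀ M' a : ℝ, Kerr.IsExtremal M' a →
    (∃ Ψ : Kerr.exterior M' a → 𝓢.carrier, Function.Injective Ψ ∧ Set.range Ψ = E.doc ∧
      PseudoRiemannianMetric.IsLocalIsometry
        (Kerr.smoothMetric M' a (Kerr.rPlus M' a)).toPseudoRiemannianMetric
        𝓢.metric.toPseudoRiemannianMetric Ψ) →
    ∃ (L : lorentzGroup) (c : E4) (a' : ℝ) (τ₀ : ℝ)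
      (Φ : (boostedKerrBackground L c M' a').domain → 𝒟.carrier), Kerr.IsExtremal M' a' ∧
      𝒟.toSpacetime.IsLateChart (boostedKerrBackground L c M' a') Set.univ τ₀ Φ ∧
        ∀ R : ℝ, Tendsto (fun τ ↦ 𝒟.toSpacetime.truncDeviationCk
          (boostedKerrBackground L c M' a') Φ 2 R τ) atTop (𝓝 0)

/-- **(i) + promotion contradict an extremal isometric d.o.c. (the special case of N where the element's convergence
is upgraded to a late chart).** If `𝒟` has no extremal remnant (hypothesis (i), `DevHyp.noRemnant`) and the candidate
limit `(𝓢, E)` is late-charted (`LateChartFromHullElement 𝒟 𝓢 E`), then every Kerr exterior `0 < M'`, `|a| ≤ M'`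
locally isometric (injectively, onto) to `E.doc` is sub-extremal: in the extremal case the promoted late chart is
exactly what (i) forbids. [cite: DafermosLuk2017, §1.2.1] -/
theorem abs_lt_of_lateChartFromHullElement {𝒟 : VacuumCauchyDevelopment D} (hi : NoExtremalRemnant 𝒟)
    {𝓢 : Spacetime.{0} 4} {E : EndDatum 𝓢} (hup : LateChartFromHullElement 𝒟 𝓢 E) [Kerr.Facts]
    {M' a : ℝ} (hM' : 0 < M') (ha : |a| ≤ M')
    (hΨ : ∃ Ψ : Kerr.exterior M' a → 𝓢.carrier, Function.Injective Ψ ∧ Set.range Ψ = E.doc ∧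
      PseudoRiemannianMetric.IsLocalIsometry
        (Kerr.smoothMetric M' a (Kerr.rPlus M' a)).toPseudoRiemannianMetric
        𝓢.metric.toPseudoRiemannianMetric Ψ) : |a| < M' := by
  rcases Kerr_abs_lt_or_isExtremal hM' ha with hlt | hext
  · exact hlt
  · obtain ⟨L, c, a', τ₀, Φ, hext', hΦ, hT⟩ := hup M' a hext hΨ
    exact absurd ⟨τ₀, Φ, hΦ, hT⟩ (hi L c M' a' hext')

/-- Conversely, a candidate limit whose d.o.c. passes the sub-extremality test is (vacuously) late-charted: the
promotion is only ever asked of extremal isometric copies. [cite: DafermosLuk2017, §1.2.1] -/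
theorem lateChartFromHullElement_of_abs_lt {𝒟 : VacuumCauchyDevelopment D} {𝓢 : Spacetime.{0} 4} {E : EndDatum 𝓢}
    (h : ∀ [Kerr.Facts], ∀ M' a : ℝ, 0 < M' → |a| ≤ M' →
      (∃ Ψ : Kerr.exterior M' a → 𝓢.carrier, Function.Injective Ψ ∧ Set.range Ψ = E.doc ∧
        PseudoRiemannianMetric.IsLocalIsometry
          (Kerr.smoothMetric M' a (Kerr.rPlus M' a)).toPseudoRiemannianMetric
          𝓢.metric.toPseudoRiemannianMetric Ψ) → |a| < M') :
    LateChartFromHullElement 𝒟 𝓢 E := fun M' a hext hΨ ↦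
  absurd (h M' a hext.2 hext.1.le hΨ) (Kerr_not_abs_lt_of_isExtremal hext)

end Development

/-- **Reduction of stub N `stub_noExtremalShadow` to ExtremalLimitPromotion (N's registered text VERBATIM as the
conclusion; registered sub-goal `noExtremalShadow_of_lateChartFromHullElement` of stmt-FinalStateConjecture-17430).**
Hypothesis: for every development as in Φ (admissible data, `DevHyp`), every class `(Λ, r₀)` and every silent hull
element `(𝓢, E, p)` — outer along some future-escaping sequence, or horizon-based along some generator path and
divergent parameter sequence — the candidate limit `(𝓢, E)` is late-charted (`LateChartFromHullElement 𝒟 𝓢 E`).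
Conclusion: N. Proof: `abs_lt_of_lateChartFromHullElement` with (i) = `DevHyp.noRemnant`. [cite: DafermosLuk2017, §1.2.1] -/
theorem noExtremalShadow_of_lateChartFromHullElement : (∀ {X : Type} [TopologicalSpace X] [ChartedSpace E3 X] [IsManifold (𝓡 3) ∞ X] [T2Space X] [SecondCountableTopology X] [ConnectedSpace X] {D : InitialDataSet (𝓡 3) X}, D ∈ admissibleVacuumData X → ∀ (𝒟 : VacuumCauchyDevelopment D) [𝒟.metric.HasLeviCivita], DevHyp 𝒟 → ∀ (Λ : ℕ → ℝ≥0) (r₀ : ℝ) (𝓢 : Spacetime.{0} 4) (E : EndDatum 𝓢) (p : 𝓢.carrier), ((∃ q : ℕ → 𝒟.carrier, IsSilentHullElement 𝒟 Λ r₀ q 𝓢 E p) ∨ (∃ (γ : ℝ → 𝒟.carrier) (s : ℕ → ℝ), IsHorizonPath 𝒟 γ ∧ Tendsto s atTop atTop ∧ IsHorizonHullElementAlong 𝒟 Λ r₀ γ s 𝓢 E p)) → LateChartFromHullElement 𝒟 𝓢 E) → ∀ (X : Type) [TopologicalSpace X] [ChartedSpace E3 X] [IsManifold (𝓡 3) ∞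 X] [T2Space X] [SecondCountableTopology X] [ConnectedSpace X], ∀ D ∈ admissibleVacuumData X, ∀ (𝒟 : VacuumCauchyDevelopment D) [𝒟.metric.HasLeviCivita], DevHyp 𝒟 → ∀ (Λ : ℕ → ℝ≥0) (r₀ : ℝ) (𝓢 : Spacetime.{0} 4) (E : EndDatum 𝓢) (p : 𝓢.carrier), ((∃ q : ℕ → 𝒟.carrier, IsSilentHullElement 𝒟 Λ r₀ q 𝓢 E p) ∨ (∃ (γ : ℝ → 𝒟.carrier) (s : ℕ → ℝ), IsHorizonPath 𝒟 γ ∧ Tendsto s atTop atTop ∧ IsHorizonHullElementAlong 𝒟 Λ r₀ γ s 𝓢 E p)) → ∀ [Kerr.Facts], ∀ M' a : ℝ, 0 < M' → |a| ≤ M' → (∃ Ψ : Kerr.exterior M' a → 𝓢.carrier, Function.Injective Ψ ∧ Set.range Ψ = E.doc ∧ PseudoRiemannianMetric.IsLocalIsometry (Kerr.smoothMetric M' a (Kerr.rPlus M' a)).toPseudoRiemannianMetric 𝓢.metric.toPseudoRiemannianMetric Ψ) → |a| < M' := by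
  intro H X _ _ _ _ _ _ D hD 𝒟 _ hdev Λ r₀ 𝓢 E p hel _ M' a hM' ha hΨ
  exact abs_lt_of_lateChartFromHullElement hdev.noRemnant (H hD 𝒟 hdev Λ r₀ 𝓢 E p hel) hM' ha hΨ

/-- **Honesty clause: the one named input, asked of all silent hull elements of developments as in Φ, is EQUIVALENT
to N** (⇐: under N an extremal isometric d.o.c. of a hull element is contradictory, so its promotion is vacuous,
`lateChartFromHullElement_of_abs_lt`). The reduction re-types N as the construction a proof must perform — a late
CHART of `𝒟` converging to boosted extremal Kerr, out of ONE subsequential limit — and does not weaken it.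
[cite: DafermosLuk2017, §1.2.1] -/
theorem noExtremalShadow_iff_lateChartFromHullElement :
    (∀ (X : Type) [TopologicalSpace X] [ChartedSpace E3 X] [IsManifold (𝓡 3) ∞ X] [T2Space X]
      [SecondCountableTopology X] [ConnectedSpace X], ∀ D ∈ admissibleVacuumData X,
      ∀ (𝒟 : VacuumCauchyDevelopment D) [𝒟.metric.HasLeviCivita], DevHyp 𝒟 →
        ∀ (Λ : ℕ → ℝ≥0) (r₀ : ℝ) (𝓢 : Spacetime.{0} 4) (E : EndDatum 𝓢) (p : 𝓢.carrier),
          ((∃ q : ℕ → 𝒟.carrier, IsSilentHullElement 𝒟 Λ r₀ q 𝓢 E p) ∨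
            (∃ (γ : ℝ → 𝒟.carrier) (s : ℕ → ℝ), IsHorizonPath 𝒟 γ ∧ Tendsto s atTop atTop ∧
              IsHorizonHullElementAlong 𝒟 Λ r₀ γ s 𝓢 E p)) →
          ∀ [Kerr.Facts], ∀ M' a : ℝ, 0 < M' → |a| ≤ M' →
            (∃ Ψ : Kerr.exterior M' a → 𝓢.carrier, Function.Injective Ψ ∧ Set.range Ψ = E.doc ∧
              PseudoRiemannianMetric.IsLocalIsometry
                (Kerr.smoothMetric M' a (Kerr.rPlus M' a)).toPseudoRiemannianMetric
                𝓢.metric.toPseudoRiemannianMetric Ψ) → |a| < M') ↔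
    (∀ (X : Type) [TopologicalSpace X] [ChartedSpace E3 X] [IsManifold (𝓡 3) ∞ X] [T2Space X]
      [SecondCountableTopology X] [ConnectedSpace X], ∀ D ∈ admissibleVacuumData X,
      ∀ (𝒟 : VacuumCauchyDevelopment D) [𝒟.metric.HasLeviCivita], DevHyp 𝒟 →
        ∀ (Λ : ℕ → ℝ≥0) (r₀ : ℝ) (𝓢 : Spacetime.{0} 4) (E : EndDatum 𝓢) (p : 𝓢.carrier),
          ((∃ q : ℕ → 𝒟.carrier, IsSilentHullElement 𝒟 Λ r₀ q 𝓢 E p) ∨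
            (∃ (γ : ℝ → 𝒟.carrier) (s : ℕ → ℝ), IsHorizonPath 𝒟 γ ∧ Tendsto s atTop atTop ∧
              IsHorizonHullElementAlong 𝒟 Λ r₀ γ s 𝓢 E p)) →
          LateChartFromHullElement 𝒟 𝓢 E) := by
  refine ⟨fun h X _ _ _ _ _ _ D hD 𝒟 _ hdev Λ r₀ 𝓢 E p hel ↦ ?_, fun h X _ _ _ _ _ _ D hD 𝒟 _ hdev Λ r₀ 𝓢 E p hel ↦ ?_⟩
  · exact lateChartFromHullElement_of_abs_lt (h X D hD 𝒟 hdev Λ r₀ 𝓢 E p hel)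
  · intro _ M' a hM' ha hΨ
    exact abs_lt_of_lateChartFromHullElement hdev.noRemnant (h X D hD 𝒟 hdev Λ r₀ 𝓢 E p hel) hM' ha hΨ

end Summit.FinalStateConjecture.FinalStateConjecture.Theorems.TameLaSalle

end
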